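import Literature.Computability.AlgebraicComplexity.PopovStabilityCriterion
import Literature.Computability.AlgebraicComplexity.BI17FiniteStabilizerLocusProofs
import Literature.Computability.AlgebraicComplexity.BI17QuadraticPolystableProofs
import Literature.Computability.AlgebraicComplexity.BI17NonNormalOrbitClosuresProofs
import HarnessLib

/-!
# BI 2017 Prop. 2.10 and Cor. 3.17 from Popov's stability criterion (edges, not strikes)

[topic Computability/AlgebraicComplexity]

Bürgisser–Ikenmeyer 2017, Prop. 2.10 ("If `D > 1`, then almost all `w ∈ Sym^D ℂ^m` are polystable",
`paper:arxiv-1511.02927` p0007.txt:L60) is the named fact `BI2017_prop_2_10`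
(`BI17FundamentalInvariantForms.lean`). Its printed proof (p0007.txt:L66–78) has three steps, all now
in the tree BY NAME:

* `D = 2`: every `SL_m`-orbit of a quadratic form of full rank is closed — PROVED,
  `BI2017_prop_2_10_two` (`BI17QuadraticPolystableProofs.lean`), which also reduces the fact to its
  range `D ≥ 3`, `m ≥ 2` (`BI2017_prop_2_10_of_main`);
* `D > 2`: "Theorem 2.3 tells us that `stab(w)` is finite for almost all `w`" — PROVED,
  `BI2017_thm_2_3_open_holds` / `isZariskiGeneric_finite_slStabilizer`
  (`BI17FiniteStabilizerLocusProofs.lean`);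
* "A general result due to Luna [Lun73], see also [Kra84, II 4.3D], implies that `SL_m w` is closed
  for almost all `w` if `SL_m ∩ stab(w)` is finite for almost all `w`" — Popov's stability criterion,
  the cited external theorem `Popov1970_genericClosedOrbit_symPower` (`PopovStabilityCriterion.lean`,
  typed, NOT proved).

Hence `BI2017_prop_2_10_of_popov`: the fact follows from Popov's criterion alone; and, through the
tree's `BI2017_cor_3_17_of_prop_2_10` (`BI17NonNormalOrbitClosuresProofs.lean`), so does
`BI2017_cor_3_17` (`BI2017_cor_3_17_of_popov`). These are EDGES of the fact DAG
(`BI2017_prop_2_10`, `BI2017_cor_3_17` ⇐ {`Popov1970_genericClosedOrbit_symPower`}), not discharges: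
both facts stay open until Popov's criterion is proved in the tree. Theorem-only. Honest framing:
VP ≠ VNP is NOT proved and nothing here bears on it.

## References

* [BurgisserIkenmeyer2017] P. Bürgisser, C. Ikenmeyer, *Fundamental invariants of orbit closures*,
  J. Algebra 477 (2017) 390–434, Prop. 2.10 (proof), Cor. 3.17.
* [Popov1970] V. L. Popov, *Stability criteria for the action of a semisimple group on a factorial
  manifold*, Math. USSR-Izv. 4 (1970) 527–535; [Kraft1984] II.4.3.D Folgerung, p. 142.
-/

noncomputable section

namespace Literature.Computability.AlgebraicComplexity

/-- **BI 2017, Prop. 2.10 from Popov's stability criterion** (the printed proof, p0007.txt:L66–78,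
with its two internal steps proved in the tree: `D = 2` by `BI2017_prop_2_10_two`, generic finiteness
of `SL_m ∩ stab(w)` for `D > 2` by `isZariskiGeneric_finite_slStabilizer`). An edge, not a strike:
`BI2017_prop_2_10 ⇐ Popov1970_genericClosedOrbit_symPower`.
[cite: BurgisserIkenmeyer2017, Prop. 2.10 (proof)] -/
theorem BI2017_prop_2_10_of_popov (h : Popov1970_genericClosedOrbit_symPower) : BI2017_prop_2_10 :=
  BI2017_prop_2_10_of_main fun D m hD hm =>
    h D m hm (isZariskiGeneric_finite_slStabilizer (by omega) (by omega))

/-- **BI 2017, Cor. 3.17 from Popov's stability criterion** (via `BI2017_cor_3_17_of_prop_2_10`: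
part 1 is proved outright, part 2 consumes Prop. 2.10). An edge, not a strike:
`BI2017_cor_3_17 ⇐ Popov1970_genericClosedOrbit_symPower`.
[cite: BurgisserIkenmeyer2017, Cor. 3.17] -/
theorem BI2017_cor_3_17_of_popov (h : Popov1970_genericClosedOrbit_symPower) : BI2017_cor_3_17 :=
  BI2017_cor_3_17_of_prop_2_10 (BI2017_prop_2_10_of_popov h)

/-- The `(D, m)`-wise form: for `D ≥ 3` and `m ≥ 2`, Popov's criterion at `(D, m)` alone gives
"almost all `w ∈ Sym^D ℂ^m` are polystable". [cite: BurgisserIkenmeyer2017, Prop. 2.10 (proof)] -/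
theorem isZariskiGeneric_isPolystable_of_popov {D m : ℕ} (hD : 3 ≤ D) (hm : 2 ≤ m)
    (h : IsZariskiGeneric D (fun f : MvPolynomial (Fin m) ℂ =>
        {g : Matrix.SpecialLinearGroup (Fin m) ℂ |
          linSubst (Fin m) ℂ (g : Matrix (Fin m) (Fin m) ℂ) f = f}.Finite) →
      IsZariskiGeneric D (IsPolystable : MvPolynomial (Fin m) ℂ → Prop)) :
    IsZariskiGeneric D (IsPolystable : MvPolynomial (Fin m) ℂ → Prop) :=
  h (isZariskiGeneric_finite_slStabilizer (by omega) (by omega))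

end Literature.Computability.AlgebraicComplexity

end
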